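import Summits.ResolutionOfSingularities.ResolutionOfSingularities.Theorems.FrobeniusLadderFInjectiveMacaulayficationCertifiedChartOfAwayChart
import Summits.ResolutionOfSingularities.ResolutionOfSingularities.Theorems.FrobeniusLadderFInjectiveMacaulayficationOfCertifiedChartClass
import Summits.ResolutionOfSingularities.ResolutionOfSingularities.Theorems.FrobeniusLadderFInjectiveMacaulayficationCNCertificates
import Summits.ResolutionOfSingularities.ResolutionOfSingularities.Theorems.FrobeniusLadderFInjectiveMacaulayficationGradedFilteredCertificates
import Summits.ResolutionOfSingularities.ResolutionOfSingularities.Theorems.FrobeniusLadderFInjectiveMacaulayficationBadPointsClosed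
import HarnessLib
/-!
# F-injective Macaulayfication for admissible pairs with certified chart models
# (crux `FInjectiveMacaulayfication`, T-𝒫 programme §4b — the door corollaries)

[OURS · L1 W4.5a · res-L1-w45a-stub-3] Support file (`--supports stmt-ResolutionOfSingularities-15315 --as helper`) for the crux
`FrobeniusLadder.FInjectiveMacaulayfication`; NOT a statement of any manuscript; AI-written, weaker than expert review.
`L/w45a/ClassGlueSig.lean` v2 239444958d057f2d / v3 74b6a04e74c75940 §4b (rulings R10.4, R11.1). ZERO named facts (no Kawasaki, no
Datta–Murayama): every theorem below is an UNCONDITIONAL door-level statement.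

* `fInjectiveMacaulayfication_of_certifiedAwayCharts` — ENGINE-AGNOSTIC FORM: an admissible pair `(X₁, f₁)` (separated, locally of
  finite type, quasi-compact over `k` of characteristic `p`; `X₁` integral, everywhere Cohen–Macaulay, finite F-bad set) each of whose
  bad points `b` has an affine open `U ∋ b` with `Γ(X₁, U) ≃+* R[1/h]` for SOME certified Noetherian domain `R` of characteristic `p`
  (ideal `I ≠ 0`, `V(I) = V(𝔪)` with `𝔪` the contraction of the prime of `b`, E6‴ certificate block) has a proper birational model
  all of whose stalks are domains, Cohen–Macaulay, with every parameter ideal Frobenius closed — §4a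
  `OfCertifiedChartClass.fInjectiveMacaulayfication_of_certifiedChartClass` (G-β-rel p505685 + §2c(ii) p506797 + §2c(iii) p507329)
  fed with `CertifiedChartOfAwayChart.certifiedChart_of_awayChartEquiv`; the alone-bad neighbourhood of `b` is `X₁ ∖ (Bad ∖ {b})`
  (`BadPointsClosed`);
* `certifiedChart_of_cnChart`, `fInjectiveMacaulayfication_of_cnChartModels` — the CN class (certificates: stub-5's
  `CNCertificates.cnCertificates`, p507472);
* `fInjectiveMacaulayfication_of_gradedChartModels`, `fInjectiveMacaulayfication_of_filteredChartModels` — classes A and ♮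
  (certificates: lead-1's `GradedFilteredCertificates.gradedCertificates` / `filteredCertificates`, p508380).

First instances: any admissible `X₁` with finitely many bad points each carrying a CN / graded / filtered away-chart (several bad
points, non-affine `X₁` allowed) — genuinely beyond the single-germ engines.
-/

-- single-problem summit: the doubled namespace component is forced
set_option linter.dupNamespace false

noncomputable section

namespace Summit.ResolutionOfSingularities.ResolutionOfSingularities.Theorems.FInjectiveMacaulayfication.OfChartModels

open AlgebraicGeometry CategoryTheory Literature.AlgebraicGeometry.Resolution TopologicalSpace
open Summit.ResolutionOfSingularities.ResolutionOfSingularities.Theorems.FInjectiveMacaulayfication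

/-! ## §1 The door corollary for certified away-charts (T-𝒫 §4b, engine-agnostic form) -/

/-- **F-INJECTIVE MACAULAYFICATION FOR ADMISSIBLE PAIRS WITH CERTIFIED AWAY-CHARTS** (T-𝒫 §4b, engine-agnostic form). An
admissible pair `(X₁, f₁)` (separated, locally of finite type, quasi-compact over `k` of characteristic `p`, `X₁` integral,
everywhere Cohen–Macaulay, finite F-bad set) each of whose bad points `b` carries an affine open `U ∋ b` with a ring isomorphism
`ε : Γ(X₁, U) ≃+* R[1/h]` (`h ≠ 0`) onto an away-localisation of SOME Noetherian domain `R` of characteristic `p` that is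
CERTIFIED — an ideal `I ≠ 0` with `V(I) = V(𝔪)`, `𝔪` the pull-back of the prime of `b`, and the E6‴ certificate block — has a
proper birational model all of whose stalks are domains, Cohen–Macaulay, with every parameter ideal Frobenius closed. ZERO named
facts: §4a `fInjectiveMacaulayfication_of_certifiedChartClass` fed with `CertifiedChartOfAwayChart.certifiedChart_of_awayChartEquiv`, the alone-bad
neighbourhood of `b` being `X₁ ∖ (Bad ∖ {b})` (`BadPointsClosed`). Engines plug in through their certificate theorems
(`CNCertificates.cnCertificates`, `GradedFilteredCertificates.gradedCertificates` / `filteredCertificates`,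
`CICertificates.ciCertificates`). [folklore] -/
theorem fInjectiveMacaulayfication_of_certifiedAwayCharts (p : ℕ) (hp : p.Prime) (k : Type) [Field k] [CharP k p]
    (X₁ : Scheme.{0}) (f₁ : X₁ ⟶ Spec (.of k)) (hsep : IsSeparated f₁) (hft : LocallyOfFiniteType f₁) (hqc : QuasiCompact f₁)
    (hint : IsIntegral X₁) (hCM : ∀ x : X₁, ∀ d : ℕ, ringKrullDim (X₁.presheaf.stalk x) = d → ∀ s : Fin d → X₁.presheaf.stalk x, (Ideal.span (Set.range s)).radical.IsMaximal → RingTheory.Sequence.IsWeaklyRegular (X₁.presheaf.stalk x) (List.ofFn s))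
    (hfin : Set.Finite {x : X₁ | ¬ ∀ d : ℕ, ringKrullDim (X₁.presheaf.stalk x) = d → ∀ s : Fin d → X₁.presheaf.stalk x, (Ideal.span (Set.range s)).radical.IsMaximal → ∀ y : X₁.presheaf.stalk x, (∃ e : ℕ, y ^ p ^ e ∈ Ideal.span ((fun z : X₁.presheaf.stalk x => z ^ p ^ e) '' (Ideal.span (Set.range s) : Set (X₁.presheaf.stalk x)))) → y ∈ Ideal.span (Set.range s)})
    (hchart : ∀ b : X₁, (¬ ∀ d : ℕ, ringKrullDim (X₁.presheaf.stalk b) = d → ∀ s : Fin d → X₁.presheaf.stalk b, (Ideal.span (Set.range s)).radical.IsMaximal → ∀ y : X₁.presheaf.stalk b, (∃ e : ℕ, y ^ p ^ e ∈ Ideal.span ((fun z : X₁.presheaf.stalk b => z ^ p ^ e) '' (Ideal.span (Set.range s) : Set (X₁.presheaf.stalk b)))) → y ∈ Ideal.span (Set.range s)) →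
      ∃ (U : X₁.affineOpens) (hbU : b ∈ (U : X₁.Opens)) (R : Type) (_ : CommRing R) (_ : IsDomain R) (_ : IsNoetherianRing R)
        (_ : CharP R p) (I 𝔪 : Ideal R) (h : R) (_ : h ≠ 0) (ε : Γ(X₁, U) ≃+* Localization.Away h),
        I ≠ ⊥ ∧ (∀ P : Ideal R, P.IsPrime → (I ≤ P ↔ 𝔪 ≤ P)) ∧
        Ideal.comap ((ε.symm : Localization.Away h →+* Γ(X₁, U)).comp (algebraMap R (Localization.Away h)))
          (U.2.primeIdealOf ⟨b, hbU⟩).asIdeal = 𝔪 ∧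
        ∃ (t : ℕ) (v : Fin t → R) (hv : ∀ j : Fin t, v j ∈ I),
          (HomogeneousIdeal.irrelevant (reesGrading (I))).toIdeal ≤ (Ideal.span (Set.range fun j : Fin t => reesT (I := I) (v j) (hv j))).radical ∧
          (∀ j : Fin t, v j ≠ 0) ∧
          ∀ (j : Fin t) (Q : Ideal (Literature.AlgebraicGeometry.Resolution.blowupAlgebra (I) (v j))) [Q.IsMaximal],
            algebraMap R (Literature.AlgebraicGeometry.Resolution.blowupAlgebra (I) (v j)) (v j) ∈ Q →
            ∀ d : ℕ, ringKrullDim (Localization.AtPrime Q) = d → ∀ s : Fin d → Localization.AtPrime Q, (Ideal.span (Set.range s)).radical.IsMaximal → RingTheory.Sequence.IsWeaklyRegular (Localization.AtPrime Q) (List.ofFn s) ∧ ∀ y : Localization.AtPrime Q, (∃ e : ℕ, y ^ p ^ e ∈ Ideal.span ((fun z : Localization.AtPrime Q => z ^ p ^ e) '' (Ideal.span (Set.range s) : Set (Localization.AtPrime Q)))) → y ∈ Ideal.span (Set.range s)) :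
    ∃ (X' : Scheme.{0}) (π : X' ⟶ X₁), IsProper π ∧ Literature.AlgebraicGeometry.Resolution.IsBirational π ∧
      ∀ x : X', IsDomain (X'.presheaf.stalk x) ∧ ∀ d : ℕ, ringKrullDim (X'.presheaf.stalk x) = d → ∀ s : Fin d → X'.presheaf.stalk x, (Ideal.span (Set.range s)).radical.IsMaximal → RingTheory.Sequence.IsWeaklyRegular (X'.presheaf.stalk x) (List.ofFn s) ∧ ∀ y : X'.presheaf.stalk x, (∃ e : ℕ, y ^ p ^ e ∈ Ideal.span ((fun z : X'.presheaf.stalk x => z ^ p ^ e) '' (Ideal.span (Set.range s) : Set (X'.presheaf.stalk x)))) → y ∈ Ideal.span (Set.range s) := by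
  haveI : Fact p.Prime := ⟨hp⟩
  refine OfCertifiedChartClass.fInjectiveMacaulayfication_of_certifiedChartClass p hp k X₁ f₁ hsep hft hqc hint hCM hfin fun b hbad => ?_
  obtain ⟨U, hbU, R, _, _, _, _, I, 𝔪, h, hh, ε, hI, hzero, hbm, hcert⟩ := hchart b hbad
  -- bad points are closed; `b` is alone-bad in the open complement of the other bad points
  have hb : IsClosed ({b} : Set X₁) := BadPointsClosed.stub_badPointsClosed p hp k X₁ f₁ hft hqc hCM hfin b hbad
  have hcl : IsClosed ({x : X₁ | ¬ ∀ d : ℕ, ringKrullDim (X₁.presheaf.stalk x) = d → ∀ s : Fin d → X₁.presheaf.stalk x, (Ideal.span (Set.range s)).radical.IsMaximal → ∀ y : X₁.presheaf.stalk x, (∃ e : ℕ, y ^ p ^ e ∈ Ideal.span ((fun z : X₁.presheaf.stalk x => z ^ p ^ e) '' (Ideal.span (Set.range s) : Set (X₁.presheaf.stalk x)))) → y ∈ Ideal.span (Set.range s)} \ {b}) := by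
    rw [← Set.biUnion_of_singleton ({x : X₁ | ¬ ∀ d : ℕ, ringKrullDim (X₁.presheaf.stalk x) = d → ∀ s : Fin d → X₁.presheaf.stalk x, (Ideal.span (Set.range s)).radical.IsMaximal → ∀ y : X₁.presheaf.stalk x, (∃ e : ℕ, y ^ p ^ e ∈ Ideal.span ((fun z : X₁.presheaf.stalk x => z ^ p ^ e) '' (Ideal.span (Set.range s) : Set (X₁.presheaf.stalk x)))) → y ∈ Ideal.span (Set.range s)} \ {b})]
    exact (hfin.subset Set.sdiff_subset).isClosed_biUnion fun x hx =>
      BadPointsClosed.stub_badPointsClosed p hp k X₁ f₁ hft hqc hCM hfin x hx.1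
  exact CertifiedChartOfAwayChart.certifiedChart_of_awayChartEquiv p X₁ b hb ⟨_, hcl.isOpen_compl⟩ (fun hmem => hmem.2 rfl)
    (fun x hx hxb => by
      by_contra hF
      exact hx ⟨hF, hxb⟩)
    U hbU R I 𝔪 h hh ε hI hzero hbm hcert

/-! ## §2 The chart-model corollary for the CN class (T-𝒫 §4b) -/

/-- **`P_cert` AT A CN CHART POINT.** `X₁` integral; `b` closed and alone-F-bad in an open `V₀`; an affine `U ∋ b` with a ring
isomorphism `ε : Γ(X₁, U) ≃+* (k[x]/(f))[1/h]` (`h ≠ 0`) under which the prime of `b` pulls back to `(x̄₁, …, x̄ₙ) ⊆ k[x]/(f)`; and a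
CN datum for `f` (the binder block of `CNCertificates.cnCertificates`, p507472 — `CNConeFiModel.cnConeFiModel` minus `hoff`). Then
`b` is in the certified-chart class: certificates by stub-5's `CNCertificates.cnCertificates` (§3b), moved by
`certifiedChart_of_awayChart`. [folklore] -/
theorem certifiedChart_of_cnChart (p : ℕ) [Fact p.Prime] (k : Type) [Field k] [CharP k p] (X₁ : Scheme.{0}) [IsIntegral X₁]
    (b : X₁) (hb : IsClosed ({b} : Set X₁))
    (V₀ : X₁.Opens) (hbV₀ : b ∈ V₀) (hV₀ : ∀ x : X₁, x ∈ V₀ → x ≠ b → ∀ d : ℕ, ringKrullDim (X₁.presheaf.stalk x) = d → ∀ s : Fin d → X₁.presheaf.stalk x, (Ideal.span (Set.range s)).radical.IsMaximal → ∀ y : X₁.presheaf.stalk x, (∃ e : ℕ, y ^ p ^ e ∈ Ideal.span ((fun z : X₁.presheaf.stalk x => z ^ p ^ e) '' (Ideal.span (Set.range s) : Set (X₁.presheaf.stalk x)))) → y ∈ Ideal.span (Set.range s))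
    (U : X₁.affineOpens) (hbU : b ∈ (U : X₁.Opens))
    (n : ℕ) (hn : 0 < n)
    (A : Finset (Fin n →₀ ℕ)) (hA0 : (0 : Fin n →₀ ℕ) ∉ A)
    (hprim : ∀ j : Fin n, ∃ e : ℕ, 0 < e ∧ Finsupp.single j e ∈ A)
    (t : ℕ) (ht : 0 < t) (V : Fin t → Matrix (Fin n) (Fin n) ℕ) (hV : ∀ c, IsUnit ((V c).map (Nat.cast : ℕ → ℤ)).det)
    (m : Fin t → (Fin n →₀ ℕ)) (hm : ∀ c, m c ∈ A) (a : Fin t → Fin n → (Fin n →₀ ℕ)) (haA : ∀ c i, a c i ∈ A)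
    (hgen : ∀ (c : Fin t) (i : Fin n), (Finsupp.equivFunOnFinite.symm ((V c).mulVec ⇑(a c i)) : Fin n →₀ ℕ) =
      Finsupp.equivFunOnFinite.symm ((V c).mulVec ⇑(m c)) + Finsupp.single i 1)
    (hge : ∀ (c : Fin t), ∀ e ∈ A, (Finsupp.equivFunOnFinite.symm ((V c).mulVec ⇑(m c)) : Fin n →₀ ℕ) ≤
      Finsupp.equivFunOnFinite.symm ((V c).mulVec ⇑e))
    (hcov : ∀ e ∈ A, ∃ (c : Fin t) (K : ℕ), 1 ≤ K ∧ ∃ y ∈ (Ideal.span ((fun b : Fin n →₀ ℕ => (MvPolynomial.monomial b (1 : k) : MvPolynomial (Fin n) k)) '' (A : Set (Fin n →₀ ℕ)))) ^ (K - 1),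
      (MvPolynomial.monomial e (1 : k) : MvPolynomial (Fin n) k) ^ K = MvPolynomial.monomial (m c) 1 * y)
    (f : MvPolynomial (Fin n) k) (hfprime : (Ideal.span {f}).IsPrime)
    (hXne : ∀ v : Fin n, Ideal.Quotient.mk (Ideal.span {f}) (MvPolynomial.X v) ≠ 0)
    (hCN : ∀ (c : Fin t) (S : Finset (Fin n)), (∀ j : Fin n, 0 < ∑ i ∈ S, V c i j) →
      (∀ D : ℕ, (MvPolynomial.weightedHomogeneousComponent (fun j : Fin n => ∑ i ∈ S, V c i j) D f ≠ 0 ∧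
          ∀ D' < D, MvPolynomial.weightedHomogeneousComponent (fun j : Fin n => ∑ i ∈ S, V c i j) D' f = 0) →
        ∀ (K : Type) [Field K] [Algebra k K] (b : Fin n → K), (∀ i, b i ≠ 0) →
          MvPolynomial.aeval b (MvPolynomial.weightedHomogeneousComponent (fun j : Fin n => ∑ i ∈ S, V c i j) D f) = 0 →
          (MvPolynomial.map (algebraMap k K) (MvPolynomial.weightedHomogeneousComponent (fun j : Fin n => ∑ i ∈ S, V c i j) D f)) ^ (p - 1) ∉
            Ideal.span (Set.range fun i : Fin n => (MvPolynomial.X i - MvPolynomial.C (b i)) ^ p)))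
    (dv : Fin t → (Fin n →₀ ℕ)) (g : Fin t → MvPolynomial (Fin n) k)
    (hg : ∀ c, MvPolynomial.aeval (fun j : Fin n => ∏ i : Fin n, (MvPolynomial.X i : MvPolynomial (Fin n) k) ^ V c i j) f = MvPolynomial.monomial (dv c) 1 * g c)
    (hndiv : ∀ c, ∀ i : Fin n, ¬ (MvPolynomial.X i ∣ g c))
    (hface : ∀ c, ∃ m ∈ f.support, ∀ i : Fin n, ∑ j : Fin n, V c i j * m j = dv c i)
    (h : (MvPolynomial (Fin n) k ⧸ Ideal.span {f})) (hh : h ≠ 0) (ε : Γ(X₁, U) ≃+* Localization.Away h)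
    (hbm : Ideal.comap ((ε.symm : Localization.Away h →+* Γ(X₁, U)).comp (algebraMap (MvPolynomial (Fin n) k ⧸ Ideal.span {f}) (Localization.Away h))) (U.2.primeIdealOf ⟨b, hbU⟩).asIdeal =
        Ideal.span (Set.range fun i : Fin n => Ideal.Quotient.mk (Ideal.span {f}) (MvPolynomial.X i))) :
    ∀ W : X₁.Opens, b ∈ W → ∃ U : X₁.affineOpens, (U : X₁.Opens) ≤ W ∧ b ∈ (U : X₁.Opens) ∧
      (∀ x : X₁, x ∈ (U : X₁.Opens) → x ≠ b → ∀ d : ℕ, ringKrullDim (X₁.presheaf.stalk x) = d → ∀ s : Fin d → X₁.presheaf.stalk x, (Ideal.span (Set.range s)).radical.IsMaximal → ∀ y : X₁.presheaf.stalk x, (∃ e : ℕ, y ^ p ^ e ∈ Ideal.span ((fun z : X₁.presheaf.stalk x => z ^ p ^ e) '' (Ideal.span (Set.range s) : Set (X₁.presheaf.stalk x)))) → y ∈ Ideal.span (Set.range s)) ∧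
      CharP Γ(X₁, U) p ∧ ∃ (I : Ideal Γ(X₁, U)), I ≠ ⊥ ∧
      (∀ (x : X₁) (hx : x ∈ (U : X₁.Opens)), I ≤ (U.2.primeIdealOf ⟨x, hx⟩).asIdeal ↔ x = b) ∧
      ∃ (t : ℕ) (v : Fin t → Γ(X₁, U)) (hv : ∀ j : Fin t, v j ∈ I),
        (HomogeneousIdeal.irrelevant (reesGrading I)).toIdeal ≤ (Ideal.span (Set.range fun j : Fin t => reesT (I := I) (v j) (hv j))).radical ∧
        (∀ j : Fin t, v j ≠ 0) ∧
        ∀ (j : Fin t) (Q : Ideal (Literature.AlgebraicGeometry.Resolution.blowupAlgebra I (v j))) [Q.IsMaximal],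
          algebraMap Γ(X₁, U) (Literature.AlgebraicGeometry.Resolution.blowupAlgebra I (v j)) (v j) ∈ Q →
          ∀ d : ℕ, ringKrullDim (Localization.AtPrime Q) = d → ∀ s : Fin d → Localization.AtPrime Q, (Ideal.span (Set.range s)).radical.IsMaximal → RingTheory.Sequence.IsWeaklyRegular (Localization.AtPrime Q) (List.ofFn s) ∧ ∀ y : Localization.AtPrime Q, (∃ e : ℕ, y ^ p ^ e ∈ Ideal.span ((fun z : Localization.AtPrime Q => z ^ p ^ e) '' (Ideal.span (Set.range s) : Set (Localization.AtPrime Q)))) → y ∈ Ideal.span (Set.range s) := by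
  classical
  haveI := hfprime
  haveI : IsDomain (MvPolynomial (Fin n) k ⧸ Ideal.span {f}) := Ideal.Quotient.isDomain _
  haveI : CharP (MvPolynomial (Fin n) k ⧸ Ideal.span {f}) p :=
    charP_of_injective_algebraMap (algebraMap k (MvPolynomial (Fin n) k ⧸ Ideal.span {f})).injective p
  -- `Γ(X₁, U)` as an `IsLocalization.Away h` algebra over `k[x]/(f)` through `ε`
  letI : Algebra (MvPolynomial (Fin n) k ⧸ Ideal.span {f}) Γ(X₁, U) :=
    ((ε.symm : Localization.Away h →+* Γ(X₁, U)).comp (algebraMap (MvPolynomial (Fin n) k ⧸ Ideal.span {f}) (Localization.Away h))).toAlgebra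
  let e : Localization.Away h ≃ₐ[(MvPolynomial (Fin n) k ⧸ Ideal.span {f})] Γ(X₁, U) :=
    { ε.symm with commutes' := fun r => rfl }
  haveI : IsLocalization.Away h Γ(X₁, U) := IsLocalization.isLocalization_of_algEquiv (Submonoid.powers h) e
  -- the CN certificates (§3b) and the zero locus of the centre
  obtain ⟨⟨hv, hcov', hv0, hon⟩, hzero⟩ :=
    CNCertificates.cnCertificates p k n hn A hA0 hprim t ht V hV m hm a haA hgen hge hcov f hfprime hXne hCN dv g hg hndiv hface
  have hI : Ideal.span ((fun b : Fin n →₀ ℕ => Ideal.Quotient.mk (Ideal.span {f}) (MvPolynomial.monomial b (1 : k))) '' (A : Set (Fin n →₀ ℕ))) ≠ ⊥ := by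
    intro h0
    apply hv0 ⟨0, ht⟩
    have hmem := hv ⟨0, ht⟩
    rw [h0] at hmem
    exact (Submodule.mem_bot _).mp hmem
  refine CertifiedChartOfAwayChart.certifiedChart_of_awayChart p X₁ b hb V₀ hbV₀ hV₀ U hbU (MvPolynomial (Fin n) k ⧸ Ideal.span {f}) h hh _
    (Ideal.span (Set.range fun i : Fin n => Ideal.Quotient.mk (Ideal.span {f}) (MvPolynomial.X i))) hI
    (fun P hP => ?_) hbm ⟨t, _, hv, hcov', hv0, hon⟩
  haveI := hP
  rw [hzero P, Ideal.span_le, Set.range_subset_iff]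
  rfl


/-- **T-𝒫 §4b — F-INJECTIVE MACAULAYFICATION FOR ADMISSIBLE PAIRS WITH CN CHART MODELS.** An admissible pair `(X₁, f₁)`
(separated, locally of finite type, quasi-compact over a field `k` of characteristic `p`, `X₁` integral, everywhere
Cohen–Macaulay, finitely many F-bad points) each of whose bad points `b` carries an affine open `U ∋ b` with a ring isomorphism
`ε : Γ(X₁, U) ≃+* (k[x]/(f))[1/h]` (`h ≠ 0`) pulling the prime of `b` back to `(x̄₁, …, x̄ₙ)`, for SOME CN datum of `f` per point
(the binder block of `CNCertificates.cnCertificates` = `CNConeFiModel.cnConeFiModel` minus `hoff`), has a proper birational model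
all of whose stalks are domains, Cohen–Macaulay, with every parameter ideal Frobenius closed. ZERO named facts: §4a
`fInjectiveMacaulayfication_of_certifiedChartClass` (G-β-rel p505685 + §2c(ii) p506797 + §2c(iii) p507329) fed with
`certifiedChart_of_cnChart`; the alone-bad neighbourhood of `b` is `X₁ ∖ (Bad ∖ {b})` (`BadPointsClosed`). [folklore] -/
theorem fInjectiveMacaulayfication_of_cnChartModels (p : ℕ) (hp : p.Prime) (k : Type) [Field k] [CharP k p]
    (X₁ : Scheme.{0}) (f₁ : X₁ ⟶ Spec (.of k)) (hsep : IsSeparated f₁) (hft : LocallyOfFiniteType f₁) (hqc : QuasiCompact f₁)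
    (hint : IsIntegral X₁) (hCM : ∀ x : X₁, ∀ d : ℕ, ringKrullDim (X₁.presheaf.stalk x) = d → ∀ s : Fin d → X₁.presheaf.stalk x, (Ideal.span (Set.range s)).radical.IsMaximal → RingTheory.Sequence.IsWeaklyRegular (X₁.presheaf.stalk x) (List.ofFn s))
    (hfin : Set.Finite {x : X₁ | ¬ ∀ d : ℕ, ringKrullDim (X₁.presheaf.stalk x) = d → ∀ s : Fin d → X₁.presheaf.stalk x, (Ideal.span (Set.range s)).radical.IsMaximal → ∀ y : X₁.presheaf.stalk x, (∃ e : ℕ, y ^ p ^ e ∈ Ideal.span ((fun z : X₁.presheaf.stalk x => z ^ p ^ e) '' (Ideal.span (Set.range s) : Set (X₁.presheaf.stalk x)))) → y ∈ Ideal.span (Set.range s)})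
    (hchart : ∀ b : X₁, (¬ ∀ d : ℕ, ringKrullDim (X₁.presheaf.stalk b) = d → ∀ s : Fin d → X₁.presheaf.stalk b, (Ideal.span (Set.range s)).radical.IsMaximal → ∀ y : X₁.presheaf.stalk b, (∃ e : ℕ, y ^ p ^ e ∈ Ideal.span ((fun z : X₁.presheaf.stalk b => z ^ p ^ e) '' (Ideal.span (Set.range s) : Set (X₁.presheaf.stalk b)))) → y ∈ Ideal.span (Set.range s)) →
      ∃ (U : X₁.affineOpens) (hbU : b ∈ (U : X₁.Opens))
        (n : ℕ) (_ : 0 < n) (A : Finset (Fin n →₀ ℕ)) (_ : (0 : Fin n →₀ ℕ) ∉ A) (_ : ∀ j : Fin n, ∃ e : ℕ, 0 < e ∧ Finsupp.single j e ∈ A) (t : ℕ) (_ : 0 < t) (V : Fin t → Matrix (Fin n) (Fin n) ℕ) (_ : ∀ c, IsUnit ((V c).map (Nat.cast : ℕ → ℤ)).det) (m : Fin t → (Fin n →₀ ℕ)) (_ : ∀ c, m c ∈ A) (a : Fin t → Fin n → (Fin n →₀ ℕ)) (_ : ∀ c i, a c i ∈ A) (_ : ∀ (c : Fin t) (i : Fin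 n), (Finsupp.equivFunOnFinite.symm ((V c).mulVec ⇑(a c i)) : Fin n →₀ ℕ) = Finsupp.equivFunOnFinite.symm ((V c).mulVec ⇑(m c)) + Finsupp.single i 1) (_ : ∀ (c : Fin t), ∀ e ∈ A, (Finsupp.equivFunOnFinite.symm ((V c).mulVec ⇑(m c)) : Fin n →₀ ℕ) ≤ Finsupp.equivFunOnFinite.symm ((V c).mulVec ⇑e)) (_ : ∀ e ∈ A, ∃ (c : Fin t) (K : ℕ), 1 ≤ K ∧ ∃ y ∈ (Ideal.span ((fun b : Fin n →₀ ℕ => (MvPolynomial.monomial b (1 : k) : MvPolynomial (Fin n) k)) '' (A : Set (Fin n →₀ ℕ)))) ^ (K - 1), (MvPolynomial.monomial e (1 : k) : MvPolynomial (Fin n) k) ^ K = MvPolynomial.monomial (m c) 1 * y) (f : MvPolynomial (Fin n) k) (_ : (Ideal.span {f}).IsPrime) (_ : ∀ v : Fin n, Ideal.Quotient.mk (Ideal.span {f}) (MvPolynomial.X v) ≠ 0) (_ : ∀ (c : Fin t) (S : Finset (Fin n)), (∀ j : Fin n, 0 < ∑ i ∈ S, V c i j) → (∀ D : ℕ, (MvPolynomial.weightedHomogeneousComponent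 (fun j : Fin n => ∑ i ∈ S, V c i j) D f ≠ 0 ∧ ∀ D' < D, MvPolynomial.weightedHomogeneousComponent (fun j : Fin n => ∑ i ∈ S, V c i j) D' f = 0) → ∀ (K : Type) [Field K] [Algebra k K] (b : Fin n → K), (∀ i, b i ≠ 0) → MvPolynomial.aeval b (MvPolynomial.weightedHomogeneousComponent (fun j : Fin n => ∑ i ∈ S, V c i j) D f) = 0 → (MvPolynomial.map (algebraMap k K) (MvPolynomial.weightedHomogeneousComponent (fun j : Fin n => ∑ i ∈ S, V c i j) D f)) ^ (p - 1) ∉ Ideal.span (Set.range fun i : Fin n => (MvPolynomial.X i - MvPolynomial.C (b i)) ^ p))) (dv : Fin t → (Fin n →₀ ℕ)) (g : Fin t → MvPolynomial (Fin n) k) (_ : ∀ c, MvPolynomial.aeval (fun j : Fin n => ∏ i : Fin n, (MvPolynomial.X i : MvPolynomial (Fin n) k) ^ V c i j) f = MvPolynomial.monomial (dv c) 1 * g c) (_ : ∀ c, ∀ i : Fin n, ¬ (MvPolynomial.X i ∣ g c)) (_ : ∀ c, ∃ m ∈ f.support, ∀ i : Fin n, ∑ j : Fin n, V c i j * m j =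 dv c i)
        (h : (MvPolynomial (Fin n) k ⧸ Ideal.span {f})) (_ : h ≠ 0) (ε : Γ(X₁, U) ≃+* Localization.Away h),
        Ideal.comap ((ε.symm : Localization.Away h →+* Γ(X₁, U)).comp (algebraMap (MvPolynomial (Fin n) k ⧸ Ideal.span {f}) (Localization.Away h))) (U.2.primeIdealOf ⟨b, hbU⟩).asIdeal =
          Ideal.span (Set.range fun i : Fin n => Ideal.Quotient.mk (Ideal.span {f}) (MvPolynomial.X i))) :
    ∃ (X' : Scheme.{0}) (π : X' ⟶ X₁), IsProper π ∧ Literature.AlgebraicGeometry.Resolution.IsBirational π ∧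
      ∀ x : X', IsDomain (X'.presheaf.stalk x) ∧ ∀ d : ℕ, ringKrullDim (X'.presheaf.stalk x) = d → ∀ s : Fin d → X'.presheaf.stalk x, (Ideal.span (Set.range s)).radical.IsMaximal → RingTheory.Sequence.IsWeaklyRegular (X'.presheaf.stalk x) (List.ofFn s) ∧ ∀ y : X'.presheaf.stalk x, (∃ e : ℕ, y ^ p ^ e ∈ Ideal.span ((fun z : X'.presheaf.stalk x => z ^ p ^ e) '' (Ideal.span (Set.range s) : Set (X'.presheaf.stalk x)))) → y ∈ Ideal.span (Set.range s) := by
  haveI : Fact p.Prime := ⟨hp⟩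
  refine fInjectiveMacaulayfication_of_certifiedAwayCharts p hp k X₁ f₁ hsep hft hqc hint hCM hfin fun b hbad => ?_
  obtain ⟨U, hbU, n, hn, A, hA0, hprim, t, ht, V, hV, m, hm, a, haA, hgen, hge, hcov, f, hfprime, hXne, hCN, dv, g, hg,
    hndiv, hface, h, hh, ε, hbm⟩ := hchart b hbad
  classical
  haveI := hfprime
  haveI : IsDomain (MvPolynomial (Fin n) k ⧸ Ideal.span {f}) := Ideal.Quotient.isDomain _
  haveI : CharP (MvPolynomial (Fin n) k ⧸ Ideal.span {f}) p :=
    charP_of_injective_algebraMap (algebraMap k (MvPolynomial (Fin n) k ⧸ Ideal.span {f})).injective p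
  obtain ⟨⟨hv, hcov', hv0, hon⟩, hzero⟩ :=
    CNCertificates.cnCertificates p k n hn A hA0 hprim t ht V hV m hm a haA hgen hge hcov f hfprime hXne hCN dv g hg hndiv hface
  have hI : Ideal.span ((fun b : Fin n →₀ ℕ => Ideal.Quotient.mk (Ideal.span {f}) (MvPolynomial.monomial b (1 : k))) '' (A : Set (Fin n →₀ ℕ))) ≠ ⊥ := by
    intro h0
    apply hv0 ⟨0, ht⟩
    have hmem := hv ⟨0, ht⟩
    rw [h0] at hmem
    exact (Submodule.mem_bot _).mp hmem
  refine ⟨U, hbU, MvPolynomial (Fin n) k ⧸ Ideal.span {f}, inferInstance, inferInstance, inferInstance, inferInstance, _,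
    Ideal.span (Set.range fun i : Fin n => Ideal.Quotient.mk (Ideal.span {f}) (MvPolynomial.X i)), h, hh, ε, hI,
    fun P hP => ?_, hbm, t, _, hv, hcov', hv0, hon⟩
  haveI := hP
  rw [hzero P, Ideal.span_le, Set.range_subset_iff]
  rfl

/-! ## §3 The chart-model corollaries for the graded (A) and filtered (♮) classes -/

/-- **T-𝒫 §4b for CLASS graded — F-INJECTIVE MACAULAYFICATION FOR ADMISSIBLE PAIRS WITH GRADED (class A) CHART MODELS.** As
`fInjectiveMacaulayfication_of_cnChartModels`, with the chart model an away-localisation of a weighted-homogeneous prime hypersurface `k[x]/(f)` whose punctured cone satisfies the clause (class A); certificates by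
lead-1's `GradedFilteredCertificates.gradedCertificates` (p508380), door by `fInjectiveMacaulayfication_of_certifiedAwayCharts`.
ZERO named facts. [folklore] -/
theorem fInjectiveMacaulayfication_of_gradedChartModels (p : ℕ) (hp : p.Prime) (k : Type) [Field k] [CharP k p]
    (X₁ : Scheme.{0}) (f₁ : X₁ ⟶ Spec (.of k)) (hsep : IsSeparated f₁) (hft : LocallyOfFiniteType f₁) (hqc : QuasiCompact f₁)
    (hint : IsIntegral X₁) (hCM : ∀ x : X₁, ∀ d : ℕ, ringKrullDim (X₁.presheaf.stalk x) = d → ∀ s : Fin d → X₁.presheaf.stalk x, (Ideal.span (Set.range s)).radical.IsMaximal → RingTheory.Sequence.IsWeaklyRegular (X₁.presheaf.stalk x) (List.ofFn s))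
    (hfin : Set.Finite {x : X₁ | ¬ ∀ d : ℕ, ringKrullDim (X₁.presheaf.stalk x) = d → ∀ s : Fin d → X₁.presheaf.stalk x, (Ideal.span (Set.range s)).radical.IsMaximal → ∀ y : X₁.presheaf.stalk x, (∃ e : ℕ, y ^ p ^ e ∈ Ideal.span ((fun z : X₁.presheaf.stalk x => z ^ p ^ e) '' (Ideal.span (Set.range s) : Set (X₁.presheaf.stalk x)))) → y ∈ Ideal.span (Set.range s)})
    (hchart : ∀ b : X₁, (¬ ∀ d : ℕ, ringKrullDim (X₁.presheaf.stalk b) = d → ∀ s : Fin d → X₁.presheaf.stalk b, (Ideal.span (Set.range s)).radical.IsMaximal → ∀ y : X₁.presheaf.stalk b, (∃ e : ℕ, y ^ p ^ e ∈ Ideal.span ((fun z : X₁.presheaf.stalk b => z ^ p ^ e) '' (Ideal.span (Set.range s) : Set (X₁.presheaf.stalk b)))) → y ∈ Ideal.span (Set.range s)) →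
      ∃ (U : X₁.affineOpens) (hbU : b ∈ (U : X₁.Opens)) (n : ℕ) (_ : 0 < n)
        (w : Fin n → ℕ) (N : ℕ) (c : Fin n → ℕ) (_ : 0 < N) (_ : ∀ v : Fin n, 0 < w v ∧ c v * w v = N) (_ : ∀ (K : ℕ) (b : Fin n →₀ ℕ), K * N ≤ Finsupp.weight w b → (MvPolynomial.monomial b (1 : k) : MvPolynomial (Fin n) k) ∈ (Ideal.span {m : MvPolynomial (Fin n) k | ∃ b : Fin n →₀ ℕ, N ≤ Finsupp.weight w b ∧ m = MvPolynomial.monomial b 1}) ^ K) (f : MvPolynomial (Fin n) k) (D : ℕ) (_ : MvPolynomial.IsWeightedHomogeneous w f D) (_ : (Ideal.span {f}).IsPrime) (_ : ∀ v : Fin n, Ideal.Quotient.mk (Ideal.span {f}) (MvPolynomial.X v) ≠ 0) (_ : ∀ (Q : Ideal (MvPolynomial (Fin n) k ⧸ Ideal.span {f})) [Q.IsMaximal], (∃ j : Fin n, Ideal.Quotient.mk (Ideal.span {f}) (MvPolynomial.X j) ∉ Q) → ∀ d : ℕ, ringKrullDim (Localization.AtPrime Q) = d → ∀ s : Fin d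 → Localization.AtPrime Q, (Ideal.span (Set.range s)).radical.IsMaximal → RingTheory.Sequence.IsWeaklyRegular (Localization.AtPrime Q) (List.ofFn s) ∧ ∀ y : Localization.AtPrime Q, (∃ e : ℕ, y ^ p ^ e ∈ Ideal.span ((fun z : Localization.AtPrime Q => z ^ p ^ e) '' (Ideal.span (Set.range s) : Set (Localization.AtPrime Q)))) → y ∈ Ideal.span (Set.range s))
        (h : (MvPolynomial (Fin n) k ⧸ Ideal.span {f})) (_ : h ≠ 0) (ε : Γ(X₁, U) ≃+* Localization.Away h),
        Ideal.comap ((ε.symm : Localization.Away h →+* Γ(X₁, U)).comp (algebraMap (MvPolynomial (Fin n) k ⧸ Ideal.span {f}) (Localization.Away h))) (U.2.primeIdealOf ⟨b, hbU⟩).asIdeal =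
          Ideal.span (Set.range fun i : Fin n => Ideal.Quotient.mk (Ideal.span {f}) (MvPolynomial.X i))) :
    ∃ (X' : Scheme.{0}) (π : X' ⟶ X₁), IsProper π ∧ Literature.AlgebraicGeometry.Resolution.IsBirational π ∧
      ∀ x : X', IsDomain (X'.presheaf.stalk x) ∧ ∀ d : ℕ, ringKrullDim (X'.presheaf.stalk x) = d → ∀ s : Fin d → X'.presheaf.stalk x, (Ideal.span (Set.range s)).radical.IsMaximal → RingTheory.Sequence.IsWeaklyRegular (X'.presheaf.stalk x) (List.ofFn s) ∧ ∀ y : X'.presheaf.stalk x, (∃ e : ℕ, y ^ p ^ e ∈ Ideal.span ((fun z : X'.presheaf.stalk x => z ^ p ^ e) '' (Ideal.span (Set.range s) : Set (X'.presheaf.stalk x)))) → y ∈ Ideal.span (Set.range s) := by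
  haveI : Fact p.Prime := ⟨hp⟩
  refine fInjectiveMacaulayfication_of_certifiedAwayCharts p hp k X₁ f₁ hsep hft hqc hint hCM hfin fun b hbad => ?_
  obtain ⟨U, hbU, n, hn, w, N, c, hN, hwc, hpow, f, D, hf, hfprime, hXne, hoff, h, hh, ε, hbm⟩ := hchart b hbad
  haveI := hfprime
  haveI : IsDomain (MvPolynomial (Fin n) k ⧸ Ideal.span {f}) := Ideal.Quotient.isDomain _
  haveI : CharP (MvPolynomial (Fin n) k ⧸ Ideal.span {f}) p :=
    charP_of_injective_algebraMap (algebraMap k (MvPolynomial (Fin n) k ⧸ Ideal.span {f})).injective p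
  obtain ⟨hI, ⟨hcov', hv0, hon⟩, hzero⟩ := GradedFilteredCertificates.gradedCertificates p k n hn w N c hN hwc hpow f D hf hfprime hXne hoff
  refine ⟨U, hbU, (MvPolynomial (Fin n) k ⧸ Ideal.span {f}), inferInstance, inferInstance, inferInstance, inferInstance, _,
    Ideal.span (Set.range fun i : Fin n => Ideal.Quotient.mk (Ideal.span {f}) (MvPolynomial.X i)), h, hh, ε, hI,
    fun P hP => ?_, hbm, n, _, _, hcov', hv0, hon⟩
  haveI := hP
  rw [hzero P, Ideal.span_le, Set.range_subset_iff]
  rfl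

/-- **T-𝒫 §4b for CLASS filtered — F-INJECTIVE MACAULAYFICATION FOR ADMISSIBLE PAIRS WITH FILTERED (class ♮) CHART MODELS.** As
`fInjectiveMacaulayfication_of_cnChartModels`, with the chart model an away-localisation of a prime hypersurface `k[x]/(f)` whose weighted tangent cone `k[x]/(in_w f)` satisfies the clause at its maximal ideals missing a variable (class ♮); certificates by
lead-1's `GradedFilteredCertificates.filteredCertificates` (p508380), door by `fInjectiveMacaulayfication_of_certifiedAwayCharts`.
ZERO named facts. [folklore] -/
theorem fInjectiveMacaulayfication_of_filteredChartModels (p : ℕ) (hp : p.Prime) (k : Type) [Field k] [CharP k p]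
    (X₁ : Scheme.{0}) (f₁ : X₁ ⟶ Spec (.of k)) (hsep : IsSeparated f₁) (hft : LocallyOfFiniteType f₁) (hqc : QuasiCompact f₁)
    (hint : IsIntegral X₁) (hCM : ∀ x : X₁, ∀ d : ℕ, ringKrullDim (X₁.presheaf.stalk x) = d → ∀ s : Fin d → X₁.presheaf.stalk x, (Ideal.span (Set.range s)).radical.IsMaximal → RingTheory.Sequence.IsWeaklyRegular (X₁.presheaf.stalk x) (List.ofFn s))
    (hfin : Set.Finite {x : X₁ | ¬ ∀ d : ℕ, ringKrullDim (X₁.presheaf.stalk x) = d → ∀ s : Fin d → X₁.presheaf.stalk x, (Ideal.span (Set.range s)).radical.IsMaximal → ∀ y : X₁.presheaf.stalk x, (∃ e : ℕ, y ^ p ^ e ∈ Ideal.span ((fun z : X₁.presheaf.stalk x => z ^ p ^ e) '' (Ideal.span (Set.range s) : Set (X₁.presheaf.stalk x)))) → y ∈ Ideal.span (Set.range s)})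
    (hchart : ∀ b : X₁, (¬ ∀ d : ℕ, ringKrullDim (X₁.presheaf.stalk b) = d → ∀ s : Fin d → X₁.presheaf.stalk b, (Ideal.span (Set.range s)).radical.IsMaximal → ∀ y : X₁.presheaf.stalk b, (∃ e : ℕ, y ^ p ^ e ∈ Ideal.span ((fun z : X₁.presheaf.stalk b => z ^ p ^ e) '' (Ideal.span (Set.range s) : Set (X₁.presheaf.stalk b)))) → y ∈ Ideal.span (Set.range s)) →
      ∃ (U : X₁.affineOpens) (hbU : b ∈ (U : X₁.Opens)) (n : ℕ) (_ : 0 < n)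
        (w : Fin n → ℕ) (N D : ℕ) (c : Fin n → ℕ) (_ : 0 < N) (_ : ∀ v : Fin n, 0 < w v ∧ c v * w v = N) (_ : ∀ (K : ℕ) (b : Fin n →₀ ℕ), K * N ≤ Finsupp.weight w b → (MvPolynomial.monomial b (1 : k) : MvPolynomial (Fin n) k) ∈ (Ideal.span {m : MvPolynomial (Fin n) k | ∃ b : Fin n →₀ ℕ, N ≤ Finsupp.weight w b ∧ m = MvPolynomial.monomial b 1}) ^ K) (f f₀ : MvPolynomial (Fin n) k) (_ : f₀ = MvPolynomial.weightedHomogeneousComponent w D f) (_ : ∀ m < D, MvPolynomial.weightedHomogeneousComponent w m f = 0) (_ : f₀ ≠ 0) (_ : (Ideal.span {f}).IsPrime) (_ : ∀ v : Fin n, Ideal.Quotient.mk (Ideal.span {f}) (MvPolynomial.X v) ≠ 0) (_ : ∀ (Q : Ideal (MvPolynomial (Fin n) k ⧸ Ideal.span {f₀})) [Q.IsMaximal], (∃ j : Fin n, Ideal.Quotient.mk (Ideal.span {f₀}) (MvPolynomial.X j) ∉ Q) → ∀ d : ℕ, ringKrullDim (Localization.AtPrime Q) = d → ∀ s : Fin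 d → Localization.AtPrime Q, (Ideal.span (Set.range s)).radical.IsMaximal → RingTheory.Sequence.IsWeaklyRegular (Localization.AtPrime Q) (List.ofFn s) ∧ ∀ y : Localization.AtPrime Q, (∃ e : ℕ, y ^ p ^ e ∈ Ideal.span ((fun z : Localization.AtPrime Q => z ^ p ^ e) '' (Ideal.span (Set.range s) : Set (Localization.AtPrime Q)))) → y ∈ Ideal.span (Set.range s))
        (h : (MvPolynomial (Fin n) k ⧸ Ideal.span {f})) (_ : h ≠ 0) (ε : Γ(X₁, U) ≃+* Localization.Away h),
        Ideal.comap ((ε.symm : Localization.Away h →+* Γ(X₁, U)).comp (algebraMap (MvPolynomial (Fin n) k ⧸ Ideal.span {f}) (Localization.Away h))) (U.2.primeIdealOf ⟨b, hbU⟩).asIdeal =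
          Ideal.span (Set.range fun i : Fin n => Ideal.Quotient.mk (Ideal.span {f}) (MvPolynomial.X i))) :
    ∃ (X' : Scheme.{0}) (π : X' ⟶ X₁), IsProper π ∧ Literature.AlgebraicGeometry.Resolution.IsBirational π ∧
      ∀ x : X', IsDomain (X'.presheaf.stalk x) ∧ ∀ d : ℕ, ringKrullDim (X'.presheaf.stalk x) = d → ∀ s : Fin d → X'.presheaf.stalk x, (Ideal.span (Set.range s)).radical.IsMaximal → RingTheory.Sequence.IsWeaklyRegular (X'.presheaf.stalk x) (List.ofFn s) ∧ ∀ y : X'.presheaf.stalk x, (∃ e : ℕ, y ^ p ^ e ∈ Ideal.span ((fun z : X'.presheaf.stalk x => z ^ p ^ e) '' (Ideal.span (Set.range s) : Set (X'.presheaf.stalk x)))) → y ∈ Ideal.span (Set.range s) := by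
  haveI : Fact p.Prime := ⟨hp⟩
  refine fInjectiveMacaulayfication_of_certifiedAwayCharts p hp k X₁ f₁ hsep hft hqc hint hCM hfin fun b hbad => ?_
  obtain ⟨U, hbU, n, hn, w, N, D, c, hN, hwc, hpow, f, f₀, hf₀, hD0, hD, hfprime, hXne, hoff₀, h, hh, ε, hbm⟩ := hchart b hbad
  haveI := hfprime
  haveI : IsDomain (MvPolynomial (Fin n) k ⧸ Ideal.span {f}) := Ideal.Quotient.isDomain _
  haveI : CharP (MvPolynomial (Fin n) k ⧸ Ideal.span {f}) p :=
    charP_of_injective_algebraMap (algebraMap k (MvPolynomial (Fin n) k ⧸ Ideal.span {f})).injective p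
  obtain ⟨hI, ⟨hcov', hv0, hon⟩, hzero⟩ := GradedFilteredCertificates.filteredCertificates p k n hn w N D c hN hwc hpow f f₀ hf₀ hD0 hD hfprime hXne hoff₀
  refine ⟨U, hbU, (MvPolynomial (Fin n) k ⧸ Ideal.span {f}), inferInstance, inferInstance, inferInstance, inferInstance, _,
    Ideal.span (Set.range fun i : Fin n => Ideal.Quotient.mk (Ideal.span {f}) (MvPolynomial.X i)), h, hh, ε, hI,
    fun P hP => ?_, hbm, n, _, _, hcov', hv0, hon⟩
  haveI := hP
  rw [hzero P, Ideal.span_le, Set.range_subset_iff]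
  rfl

end Summit.ResolutionOfSingularities.ResolutionOfSingularities.Theorems.FInjectiveMacaulayfication.OfChartModels

end
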